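import Mathlib
import Summits.NavierStokesRegularity.NavierStokesRegularity.Theorems.EulerZoomLiouvillePowerGaugeEulerLiouvilleNeedleStrainClock
import Summits.NavierStokesRegularity.NavierStokesRegularity.Theorems.EulerZoomLiouvillePowerGaugeEulerLiouvilleNeedleClockThresholdMember
import Summits.NavierStokesRegularity.NavierStokesRegularity.Theorems.EulerZoomLiouvillePowerGaugeEulerLiouvilleSelfSimilarPastStrata
import HarnessLib.Audit

/-!
# Crux E `EulerZoomLiouville.PowerGaugeEulerLiouville` — SUBCRITICAL STRAIN CLOCKS AT MEMBER LEVEL (plate t40d (S5) of ROUND-40):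
# a `C²` profile with subcritical stretching and a sub-power vorticity envelope carries a residence clock, hence is trivial

Route №10 `EulerZoomLiouville` (NavierStokesRegularity), crux E = stmt-NavierStokesRegularity-19832, registered residue
`stub_selfSimilarC2Needle` (THE ONE STATEMENT, LEAD ns-typeII-p2 g12, skeleton v68); memo ROUND-40 of the cell
`ns-regularity-ideate` (text custody nsreg-p2 g33, plate spec t40d 15:57:11Z); seat ns-ezl-w5 g3,
`--supports stmt-NavierStokesRegularity-19832 --as helper`.  By-name assembly of this seat's STRETCHING CLOCK
(`NeedleClock.norm_curl_mul_exp_le_of_stretching_linger`, …NeedleStrainClock) with ns-ezl-w2 g3's WAITING-TIME EXPONENT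
AT MEMBER LEVEL (`NeedleRace.selfSimilar_ae_eq_zero_of_subcriticalClockC2`, …NeedleClockThresholdMember, p645025):

* `NeedleClock.linger_set_eq_empty_of_subcriticalStrain` (profile level) — `(V, P′)` a classical self-similar Euler profile at
  rate `γ = 1/(2+ρ)`, `ρ ≥ 0`, with SUBCRITICAL STRETCHING `⟪DV(z) v, v⟫ ≤ s‖v‖²` (`s < 1`, all `z`, `v`) and a SUB-POWER
  VORTICITY ENVELOPE `log ‖curl V z‖ = o(‖z‖^{2+ρ})`: around every vortical point `x₀` there is a ball `B(x₀, r)` such that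
  for every `c′ > 0`, all large `R`, and every `C²` globally Lipschitz cut-off copy `V′ = V` on `ball 0 R_big ⊋ B̄_{2R}`, the
  LINGERING SET `B(x₀,r) ∩ {y | ∀ σ ∈ [0, c′R^{2+ρ}], ‖Ψ_σ y‖ ≤ 2R}` is EMPTY (vorticity would have to grow by
  `e^{(1−s)c′R^{2+ρ}}` inside `B̄_{2R}`, where it is at most `B·e^{(1−s)c′R^{2+ρ}/2}`);
* `NeedleClock.powerClock_of_subcriticalStrain` — hence the POWER alternative of the skeleton's `HasResidenceClock ρ V`
  (p645025's `hclock` VERBATIM: at most half of the ball lingers — here none does) for EVERY `c′ > 0`;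
* **`NeedleRace.selfSimilar_ae_eq_zero_of_strainClockC2`** (member level; LEAD 16:01:13Z (3) name) — crux hypotheses
  verbatim (`0 < ρ ≤ ½`) + exact self-similarity about the origin with a `C²` profile `V` + subcritical stretching + sub-power
  vorticity envelope ⇒ `u = 0` a.e. (the classical pressure is manufactured by `Past.exists_isSelfSimilarEulerProfile`).

Suggested predicate text for the skeleton (LEAD's choice: a THIRD alternative of `HasResidenceClock ρ V`, which it implies by
`powerClock_of_subcriticalStrain`, or a separate binder):
`HasSubcriticalStrainClock ρ V := (∃ s : ℝ, s < 1 ∧ ∀ z v : E3, ⟪fderiv ℝ V z v, v⟫ ≤ s * ‖v‖ ^ 2) ∧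
  (∀ ε : ℝ, 0 < ε → ∃ R₂ : ℝ, ∀ z : E3, R₂ ≤ ‖z‖ → Real.log ‖curl V z‖ ≤ ε * ‖z‖ ^ (2 + ρ))`.
REMARK: by `tr DV = 0` a subcritical COMPRESSION rate `−k‖v‖² ≤ ⟪DV(z) v, v⟫`, `k < 1/2`, implies subcritical stretching
with `s = 2k`; both are sharp at vortical `W`-nodes (stretching rate exactly `1` there).

NOT NS, not E: a conditional stratum of the crux CLASS (MODEL lattice); 19832 OPEN.  References: Constantin–Ignatova–Vicol
arXiv:2602.17570 §3.4–§3.5 [ConstantinIgnatovaVicol2026Putative]; Grönwall [folklore].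
-/

noncomputable section

-- the summit and its single problem share the name `NavierStokesRegularity` (D-0017 nested layout)
set_option linter.dupNamespace false

open Set Filter Topology Metric Function MeasureTheory InnerProductSpace
open scoped RealInnerProductSpace NNReal ENNReal

namespace Summit.NavierStokesRegularity.NavierStokesRegularity.Theorems.PowerGaugeEulerLiouville

open Literature.Analysis Literature.Analysis.FluidPDE

/-! ## Profile level: subcritical stretching + sub-power vorticity envelope ⇒ empty lingering sets ⇒ power clock -/

namespace NeedleClock

variable {ρ : ℝ} {V : EuclideanSpace ℝ (Fin 3) → EuclideanSpace ℝ (Fin 3)} {P' : EuclideanSpace ℝ (Fin 3) → ℝ}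

/-- **EMPTY LINGERING SETS under subcritical stretching and a sub-power vorticity envelope.**  `(V, P′)` a classical
self-similar Euler profile at rate `1/(2+ρ)`, `ρ ≥ 0`; stretching `⟪DV(z) v, v⟫ ≤ s‖v‖²` everywhere with `s < 1`;
`log ‖curl V z‖ ≤ ε‖z‖^{2+ρ}` beyond some radius, for every `ε > 0`.  Then around every vortical point `x₀` there is `r > 0`
such that for every `c′ > 0` there is `R₀` with: for all `R ≥ R₀` and every `C²` cut-off copy `V′` (`‖DV′‖ ≤ K`, `V′ = V` on
`ball 0 R_big`, `2R < R_big`), NO label of `B(x₀, r)` lingers in `‖·‖ ≤ 2R` during backward similarity time `[0, c′R^{2+ρ}]`.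
[cite: ConstantinIgnatovaVicol2026Putative, §3.4.1 eq. (3.23)–(3.24)] -/
theorem linger_set_eq_empty_of_subcriticalStrain (hprof : IsSelfSimilarEulerProfile (1 / (2 + ρ)) 0 V P') (hρ : -1 ≤ ρ)
    {s : ℝ} (hs1 : s < 1)
    (hstrain : ∀ z v : EuclideanSpace ℝ (Fin 3), ⟪fderiv ℝ V z v, v⟫ ≤ s * ‖v‖ ^ 2)
    (henv : ∀ ε : ℝ, 0 < ε → ∃ R₂ : ℝ, ∀ z : EuclideanSpace ℝ (Fin 3), R₂ ≤ ‖z‖ →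
      Real.log ‖curl V z‖ ≤ ε * ‖z‖ ^ (2 + ρ))
    {x₀ : EuclideanSpace ℝ (Fin 3)} (hx₀ : curl V x₀ ≠ 0) :
    ∃ r : ℝ, 0 < r ∧ ∀ c' : ℝ, 0 < c' → ∃ R₀ : ℝ, ∀ R : ℝ, R₀ ≤ R →
      ∀ (V' : EuclideanSpace ℝ (Fin 3) → EuclideanSpace ℝ (Fin 3)) (K Rbig : ℝ), ContDiff ℝ 2 V' →
        (∀ y, ‖fderiv ℝ V' y‖ ≤ K) → 2 * R < Rbig →
        (∀ w ∈ ball (0 : EuclideanSpace ℝ (Fin 3)) Rbig, V' w = V w) →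
        ball x₀ r ∩ {y | ∀ σ ∈ Icc 0 (c' * R ^ (2 + ρ)),
          ‖ODE.evolutionMap (fun _ : ℝ => selfSimilarTransport (1 / (2 + ρ)) 0 V') 0 (-σ) y‖ ≤ 2 * R} = ∅ := by
  have hU2 : ContDiff ℝ 2 V := hprof.contDiff_velocity
  have hcurlc : Continuous (curl V) := (differentiable_curl_of_contDiff hU2).continuous
  -- a ball around `x₀` on which `‖curl V‖ > ‖curl V x₀‖ / 2`
  set ω₀ : ℝ := ‖curl V x₀‖ with hω₀
  have hω₀pos : 0 < ω₀ := norm_pos_iff.2 hx₀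
  have hopen : IsOpen {y : EuclideanSpace ℝ (Fin 3) | ω₀ / 2 < ‖curl V y‖} :=
    isOpen_lt continuous_const hcurlc.norm
  have hx₀mem : x₀ ∈ {y : EuclideanSpace ℝ (Fin 3) | ω₀ / 2 < ‖curl V y‖} := by
    show ω₀ / 2 < ‖curl V x₀‖
    rw [← hω₀]; linarith
  obtain ⟨r, hr, hball⟩ := Metric.isOpen_iff.1 hopen x₀ hx₀mem
  refine ⟨r, hr, fun c' hc' => ?_⟩
  have h1s : 0 < 1 - s := by linarith
  -- the vorticity envelope at scale `ε := (1 − s) c′ / (2 · 2^{2+ρ})`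
  have h2pow : (0 : ℝ) < (2 : ℝ) ^ (2 + ρ) := Real.rpow_pos_of_pos two_pos _
  set ε : ℝ := (1 - s) * c' / (2 * (2 : ℝ) ^ (2 + ρ)) with hε
  have hεpos : 0 < ε := by rw [hε]; positivity
  obtain ⟨R₂, hR₂⟩ := henv ε hεpos
  obtain ⟨B, hB⟩ := (isCompact_closedBall (0 : EuclideanSpace ℝ (Fin 3)) (max R₂ 0)).exists_bound_of_continuousOn
    hcurlc.continuousOn
  set B₁ : ℝ := max B 1 with hB₁
  have hB₁1 : 1 ≤ B₁ := le_max_right _ _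
  have hB₁pos : 0 < B₁ := lt_of_lt_of_le one_pos hB₁1
  -- the threshold radius
  set R₀ : ℝ := max 1 (2 * Real.log (2 * B₁ / ω₀) / ((1 - s) * c') + 1) with hR₀
  refine ⟨R₀, fun R hR V' K Rbig hV' hK hRbig hVU => ?_⟩
  have hR1 : 1 ≤ R := le_trans (le_max_left _ _) hR
  have hR0 : 0 < R := by linarith
  have hRlog : 2 * Real.log (2 * B₁ / ω₀) / ((1 - s) * c') < R :=
    lt_of_lt_of_le (by linarith [le_max_right 1 (2 * Real.log (2 * B₁ / ω₀) / ((1 - s) * c') + 1)]) hR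
  have hRpow : R ≤ R ^ (2 + ρ) := by
    calc R = R ^ (1 : ℝ) := (Real.rpow_one R).symm
      _ ≤ R ^ (2 + ρ) := Real.rpow_le_rpow_of_exponent_le hR1 (by linarith)
  have hRpow0 : 0 ≤ R ^ (2 + ρ) := by positivity
  -- the uniform vorticity bound on `B̄_{2R}`: `O := B₁ · exp ((1−s) c′ R^{2+ρ} / 2)`
  set E₂ : ℝ := (1 - s) * c' * R ^ (2 + ρ) / 2 with hE₂
  have hE₂0 : 0 ≤ E₂ := by rw [hE₂]; positivity
  set O : ℝ := B₁ * Real.exp E₂ with hOdef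
  have hO : ∀ z ∈ closedBall (0 : EuclideanSpace ℝ (Fin 3)) (2 * R), ‖curl V z‖ ≤ O := by
    intro z hz
    rw [mem_closedBall_zero_iff] at hz
    by_cases hzR : ‖z‖ ≤ max R₂ 0
    · -- near the origin: the compact bound
      have h1 : ‖curl V z‖ ≤ B₁ := (hB z (mem_closedBall_zero_iff.2 hzR)).trans (le_max_left _ _)
      calc ‖curl V z‖ ≤ B₁ * 1 := by rw [mul_one]; exact h1
        _ ≤ O := mul_le_mul_of_nonneg_left (Real.one_le_exp hE₂0) hB₁pos.le
    · -- far out: the envelope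
      rw [not_le] at hzR
      have hzR₂ : R₂ ≤ ‖z‖ := le_trans (le_max_left _ _) hzR.le
      have hlog : Real.log ‖curl V z‖ ≤ E₂ := by
        refine (hR₂ z hzR₂).trans ?_
        have hzpow : ‖z‖ ^ (2 + ρ) ≤ (2 : ℝ) ^ (2 + ρ) * R ^ (2 + ρ) := by
          calc ‖z‖ ^ (2 + ρ) ≤ (2 * R) ^ (2 + ρ) := Real.rpow_le_rpow (norm_nonneg _) hz (by linarith)
            _ = (2 : ℝ) ^ (2 + ρ) * R ^ (2 + ρ) := Real.mul_rpow (by norm_num) hR0.le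
        calc ε * ‖z‖ ^ (2 + ρ) ≤ ε * ((2 : ℝ) ^ (2 + ρ) * R ^ (2 + ρ)) :=
              mul_le_mul_of_nonneg_left hzpow hεpos.le
          _ = E₂ := by rw [hε, hE₂]; field_simp
      by_cases hcz : curl V z = 0
      · rw [hcz, norm_zero]; positivity
      · have hpos : 0 < ‖curl V z‖ := norm_pos_iff.2 hcz
        calc ‖curl V z‖ = Real.exp (Real.log ‖curl V z‖) := (Real.exp_log hpos).symm
          _ ≤ Real.exp E₂ := Real.exp_le_exp.2 hlog
          _ = 1 * Real.exp E₂ := (one_mul _).symm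
          _ ≤ O := mul_le_mul_of_nonneg_right hB₁1 (Real.exp_pos _).le
  -- emptiness: a lingering label of the ball would violate the stretching clock
  refine eq_empty_iff_forall_notMem.2 fun y hy => ?_
  obtain ⟨hyball, hylinger⟩ := hy
  have hyω : ω₀ / 2 < ‖curl V y‖ := hball hyball
  set L : ℝ := c' * R ^ (2 + ρ) with hL
  have hL0 : 0 ≤ L := by rw [hL]; positivity
  have hclock := norm_curl_mul_exp_le_of_stretching_linger (γ := 1 / (2 + ρ)) (U := V) (V := V') hprof hV' hK hRbig
    hVU (fun z _ v => hstrain z v) hO hylinger (right_mem_Icc.2 hL0)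
  -- `(ω₀/2)·e^{2E₂} < B₁·e^{E₂}`, i.e. `e^{E₂} < 2B₁/ω₀`
  have hexpL : Real.exp ((1 - s) * L) = Real.exp E₂ * Real.exp E₂ := by
    rw [← Real.exp_add, hL, hE₂]; ring_nf
  have h1 : ω₀ / 2 * (Real.exp E₂ * Real.exp E₂) < B₁ * Real.exp E₂ := by
    calc ω₀ / 2 * (Real.exp E₂ * Real.exp E₂) < ‖curl V y‖ * (Real.exp E₂ * Real.exp E₂) :=
          mul_lt_mul_of_pos_right hyω (by positivity)
      _ = ‖curl V y‖ * Real.exp ((1 - s) * L) := by rw [hexpL]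
      _ ≤ O := hclock
      _ = B₁ * Real.exp E₂ := rfl
  have h2 : Real.exp E₂ < 2 * B₁ / ω₀ := by
    rw [lt_div_iff₀ hω₀pos]
    have hE : 0 < Real.exp E₂ := Real.exp_pos _
    nlinarith [h1, hE]
  have h3 : E₂ < Real.log (2 * B₁ / ω₀) := by
    have := Real.log_lt_log (Real.exp_pos _) h2
    rwa [Real.log_exp] at this
  -- but `E₂ ≥ (1−s) c′ R / 2 > log (2B₁/ω₀)`
  have h4 : Real.log (2 * B₁ / ω₀) < E₂ := by
    have h5 : 2 * Real.log (2 * B₁ / ω₀) < (1 - s) * c' * R := by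
      have := (div_lt_iff₀ (by positivity : (0 : ℝ) < (1 - s) * c')).1 hRlog
      linarith
    have h6 : (1 - s) * c' * R ≤ (1 - s) * c' * R ^ (2 + ρ) :=
      mul_le_mul_of_nonneg_left hRpow (by positivity)
    rw [hE₂]; linarith
  exact absurd (h3.trans h4) (lt_irrefl _)

/-- **THE POWER RESIDENCE CLOCK from subcritical stretching.**  Under the hypotheses of
`linger_set_eq_empty_of_subcriticalStrain`, the profile carries the POWER alternative of the skeleton's `HasResidenceClock ρ V`
— p645025's `hclock` VERBATIM: for EVERY `c′ > 0`, around every vortical point a ball at most half of whose labels (here: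
none) linger in `‖·‖ ≤ 2R` during backward similarity time `c′R^{2+ρ}`, all large `R`, every cut-off copy.
[cite: ConstantinIgnatovaVicol2026Putative, §3.5] -/
theorem powerClock_of_subcriticalStrain (hprof : IsSelfSimilarEulerProfile (1 / (2 + ρ)) 0 V P') (hρ : -1 ≤ ρ)
    {s : ℝ} (hs1 : s < 1)
    (hstrain : ∀ z v : EuclideanSpace ℝ (Fin 3), ⟪fderiv ℝ V z v, v⟫ ≤ s * ‖v‖ ^ 2)
    (henv : ∀ ε : ℝ, 0 < ε → ∃ R₂ : ℝ, ∀ z : EuclideanSpace ℝ (Fin 3), R₂ ≤ ‖z‖ →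
      Real.log ‖curl V z‖ ≤ ε * ‖z‖ ^ (2 + ρ)) :
    ∀ c' : ℝ, 0 < c' → ∀ x₀ : EuclideanSpace ℝ (Fin 3), curl V x₀ ≠ 0 → ∃ r : ℝ, 0 < r ∧ ∃ R₀ : ℝ,
      ∀ R : ℝ, R₀ ≤ R → ∀ (V' : EuclideanSpace ℝ (Fin 3) → EuclideanSpace ℝ (Fin 3)) (K Rbig : ℝ), ContDiff ℝ 2 V' →
        (∀ y, ‖fderiv ℝ V' y‖ ≤ K) → 2 * R < Rbig →
        (∀ w ∈ ball (0 : EuclideanSpace ℝ (Fin 3)) Rbig, V' w = V w) →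
        (volume (ball x₀ r ∩ {y | ∀ σ ∈ Icc 0 (c' * R ^ (2 + ρ)),
          ‖ODE.evolutionMap (fun _ : ℝ => selfSimilarTransport (1 / (2 + ρ)) 0 V') 0 (-σ) y‖ ≤ 2 * R})).toReal ≤
          (volume (ball x₀ r)).toReal / 2 := by
  intro c' hc' x₀ hx₀
  obtain ⟨r, hr, hR⟩ := linger_set_eq_empty_of_subcriticalStrain hprof hρ hs1 hstrain henv hx₀
  obtain ⟨R₀, hR₀⟩ := hR c' hc'
  refine ⟨r, hr, R₀, fun R hRR V' K Rbig hV' hK hRbig hVU => ?_⟩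
  rw [hR₀ R hRR V' K Rbig hV' hK hRbig hVU, measure_empty, ENNReal.toReal_zero]
  positivity

end NeedleClock

/-! ## Member level -/

namespace NeedleRace

variable {V : EuclideanSpace ℝ (Fin 3) → EuclideanSpace ℝ (Fin 3)}

/-- **SUBCRITICAL STRAIN CLOCKS AT MEMBER LEVEL (ROUND-40 t40d (S5)).**  An exactly self-similar member of the window class
(`0 < ρ ≤ ½`, crux hypotheses verbatim) with a `C²` velocity profile `V` such that
(i) the STRETCHING RATE is subcritical, `⟪DV(z) v, v⟫ ≤ s‖v‖²` for all `z, v` with `s < 1`, and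
(ii) the vorticity has a SUB-POWER ENVELOPE, `log ‖curl V z‖ ≤ ε‖z‖^{2+ρ}` beyond some radius for every `ε > 0`,
is trivial: (i)+(ii) give the power residence clock (`NeedleClock.powerClock_of_subcriticalStrain`) and the waiting-time
exponent `2+ρ` (p645025 `selfSimilar_ae_eq_zero_of_subcriticalClockC2`) closes.
[cite: ConstantinIgnatovaVicol2026Putative, §3.5] -/
theorem selfSimilar_ae_eq_zero_of_strainClockC2 {ρ : ℝ} (hρ : 0 < ρ) (hρ1 : ρ ≤ 1 / 2)
    {u : ℝ → EuclideanSpace ℝ (Fin 3) → EuclideanSpace ℝ (Fin 3)} {p : ℝ → EuclideanSpace ℝ (Fin 3) → ℝ}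
    {H : ℝ → EuclideanSpace ℝ (Fin 3) → EuclideanSpace ℝ (Fin 3) →L[ℝ] EuclideanSpace ℝ (Fin 3)} {c : ℝ≥0}
    (hsw : IsSuitableWeakSolutionOn (slab (EuclideanSpace ℝ (Fin 3)) (Iio 0) isOpen_Iio) 0 0 u p)
    (hH : HasWeakSpatialGradientOn (slab (EuclideanSpace ℝ (Fin 3)) (Iio 0) isOpen_Iio) u H)
    (hgauge : ∀ a : ℝ, 0 < a →
      ENNReal.ofReal (a ^ (2 * ρ)) * cknA a (0 : ℝ × EuclideanSpace ℝ (Fin 3)) u +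
          ENNReal.ofReal (a ^ ρ) * cknE a (0 : ℝ × EuclideanSpace ℝ (Fin 3)) H +
        ENNReal.ofReal (a ^ (2 * ρ)) * cknD a (0 : ℝ × EuclideanSpace ℝ (Fin 3)) p ≤ (c : ℝ≥0∞))
    {P : EuclideanSpace ℝ (Fin 3) → ℝ}
    (hu : ∀ τ : ℝ, τ < 0 → u τ = selfSimilarCollapse (1 / (2 + ρ)) 0 V τ)
    (hp : ∀ τ : ℝ, τ < 0 → p τ = selfSimilarCollapsePressure (1 / (2 + ρ)) 0 P τ)
    (hV : ContDiff ℝ 2 V) {s : ℝ} (hs1 : s < 1)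
    (hstrain : ∀ z v : EuclideanSpace ℝ (Fin 3), ⟪fderiv ℝ V z v, v⟫ ≤ s * ‖v‖ ^ 2)
    (henv : ∀ ε : ℝ, 0 < ε → ∃ R₂ : ℝ, ∀ z : EuclideanSpace ℝ (Fin 3), R₂ ≤ ‖z‖ →
      Real.log ‖curl V z‖ ≤ ε * ‖z‖ ^ (2 + ρ)) :
    uncurry u =ᵐ[volume.restrict (Iio (0 : ℝ) ×ˢ (univ : Set (EuclideanSpace ℝ (Fin 3))))] 0 := by
  -- the classical profile equation for some `C¹` pressure
  have hu' : ∀ τ : ℝ, τ < 0 → u τ = fun x => selfSimilarCollapse (1 / (2 + ρ)) 0 V τ (x - 0) := by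
    intro τ hτ; rw [hu τ hτ]; funext x; rw [sub_zero]
  have hp' : ∀ τ : ℝ, τ < 0 → p τ = fun x => selfSimilarCollapsePressure (1 / (2 + ρ)) 0 P τ (x - 0) := by
    intro τ hτ; rw [hp τ hτ]; funext x; rw [sub_zero]
  obtain ⟨P', hprof⟩ := Past.exists_isSelfSimilarEulerProfile hρ le_rfl le_rfl hsw.distributional hu' hp' hV
  exact selfSimilar_ae_eq_zero_of_subcriticalClockC2 hρ hρ1 hsw hH hgauge hu hp hV
    (NeedleClock.powerClock_of_subcriticalStrain hprof (by linarith) hs1 hstrain henv)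

end NeedleRace

end Summit.NavierStokesRegularity.NavierStokesRegularity.Theorems.PowerGaugeEulerLiouville

end
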